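import Mathlib.Analysis.Matrix.HermitianFunctionalCalculus
import Mathlib.Analysis.Matrix.PosDef
import HarnessLib

/-!
# The Kennedy–Lieb chessboard bound for the Falicov–Kimball one-body operator

Topic `MathematicalPhysics/QuantumLattice`. The one-body (matrix-analysis) heart of the
Kennedy–Lieb theorem on crystalline order in the itinerant-electron (Falicov–Kimball) model at the
symmetric point, in the form printed by Lieb–Loss (Duke Math. J. 71 (1993), §8, "a transcription
… of Lemma 2.2 and Theorem 2.1 in [KL]"), everything PROVED:

* the setting: a finite vertex set `ι` with a two-colouring `p : ι → Bool`, a Hermitian hopping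
  matrix `K` which is *bipartite* for `p` (`K x y = 0` when `p x = p y`; no planarity, connectedness
  or `|A| = |B|` is needed), a coupling `u : ℝ` and a classical configuration `s : ι → ℝ` with
  `|s x| ≤ 1` (Kennedy–Lieb: `s_x = 2w_x - 1 ∈ {±1}`); the one-body operator
  `fkOneBody K u s = -K + u diag(s)` [LiebLoss1993, (8.4)], the sublattice gauge `gauge p = V`
  [LiebLoss1993, (8.5)] and its chessboard configuration `chessboard p` (`S = V`);
* `traceAbs A = Tr |A| = Σᵢ |λᵢ(A)|` (`traceAbs_eq_sum_abs_eigenvalues`), written through Mathlib's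
  continuous functional calculus of Hermitian matrices;
* **the Kennedy–Lieb inequality** `traceAbs_fkOneBody_le`:
  `Tr |-K + uS| ≤ Σᵢ √(λᵢ(K)² + u²)` (`= Tr √(K² + u²)`), with **equality at the chessboard**
  `traceAbs_fkOneBody_chessboard` (`(-K + uV)² = K² + u²` since `KV + VK = 0`), hence
  `traceAbs_fkOneBody_le_chessboard`: `Tr|h(s)|` is maximal at `S = ±V`
  [KennedyLieb1986, Lemma 2.2 / Theorem 2.1; LiebLoss1993, Lemma 8.1 with `F = Tr √·`];
* **the Langer–Mattis one-body bound** `re_trace_mul_ge_of_le_one`: for `0 ≤ γ ≤ 1`,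
  `Re Tr (A γ) ≥ ½ (Re Tr A - Tr|A|)` = the sum of the negative eigenvalues of `A`, and its
  eigenvalue form `sum_eigenvalues_ge` [LiebLoss1993, proof of Theorem 8.2];
* the assembled configuration-independent bounds `kennedyLieb_re_trace_mul_ge`,
  `kennedyLieb_sum_eigenvalues_ge`: `Re Tr (h(s) γ)` and every partial sum of eigenvalues of `h(s)`
  are `≥ ½ (u Σ_x s_x - Σᵢ √(λᵢ(K)² + u²))` — the input of the Falicov–Kimball / Kennedy–Lieb
  lower bounds for the Hubbard model (`Tr K = 0` for bipartite `K`).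

Proof. Lieb–Loss: `Tr|h| = Tr √(h²)`, `h' := VhV = K + uS` has the same value, and
`½ (h² + h'²) = K² + u²S² ≤ K² + u²`, so the claim follows from the concavity and monotonicity of
`P ↦ Tr √P`. We follow this architecture but carry out the concavity step by an explicit
Cauchy–Schwarz argument, which avoids operator concavity: with `m = √(K² + u²)`, its fourth roots
`R = m^{1/2}`, `R⁻¹` (all functions of `K`, `u ≠ 0`) and `W = sgn(h)` (`W² = 1`, `hW = |h|`),
`Tr|h| = Re Tr ((h R⁻¹)(R W)) ≤ (Re Tr (h m⁻¹ h))^{1/2} (Tr m)^{1/2}` (`re_trace_mul_le`), the same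
for `h'` with `W' = VWV`, and `Tr (h m⁻¹ h) + Tr (h' m⁻¹ h') = 2 Tr (m⁻¹ (K² + u²S²)) ≤ 2 Tr m`
because `m⁻¹ = R⁻¹R⁻¹ ⪰ 0` and `u² - u²S² ⪰ 0`; then `t ≤ √a√c`, `t ≤ √a'√c`, `a + a' ≤ 2c`
force `t ≤ c` (`le_of_two_cauchySchwarz`). The case `u = 0` is the identity `Tr|-K| = Tr|K|`.

References: T. Kennedy, E. H. Lieb, *An itinerant electron model with crystalline or magnetic
long range order*, Physica A 138 (1986) 320–358, Lemma 2.2 and Theorem 2.1 [KennedyLieb1986];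
E. H. Lieb, M. Loss, *Fluxes, Laplacians, and Kasteleyn's theorem*, Duke Math. J. 71 (1993)
337–363, §8, Lemma 8.1 and Theorem 8.2 [LiebLoss1993]. No named facts; the definitions are
`traceAbs`, `fkOneBody`, `gauge`, `chessboard` and the scalar bookkeeping functions `sgn`, `sqrtQ`,
`rootQ`, `rootQInv`, `sqrtQInv`.
-/

noncomputable section

open Matrix Complex Finset
open scoped ComplexOrder BigOperators

namespace Literature.MathematicalPhysics.QuantumLattice.FalicovKimball

variable {ι : Type*} [Fintype ι] [DecidableEq ι]

/-! ### Trace of a function of a Hermitian matrix -/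

/-- `Re Tr f(A) = Σᵢ f(λᵢ(A))` for a Hermitian matrix `A` (spectral theorem). [folklore] -/
theorem re_trace_cfc (A : Matrix ι ι ℂ) (hA : A.IsHermitian) (f : ℝ → ℝ) :
    (Matrix.trace (cfc f A)).re = ∑ i, f (hA.eigenvalues i) := by
  rw [hA.cfc_eq f, Matrix.IsHermitian.cfc, Unitary.conjStarAlgAut_apply, trace_mul_cycle,
    Unitary.coe_star_mul_self, one_mul, trace_diagonal, Complex.re_sum]
  simp

/-- The trace norm `Tr |A| = Σᵢ |λᵢ(A)|` of a Hermitian matrix, written through the functional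
calculus (`|A| = f(A)` with `f = |·|`). [folklore] -/
def traceAbs (A : Matrix ι ι ℂ) : ℝ := (Matrix.trace (cfc (fun x : ℝ => |x|) A)).re

/-- `Tr |A| = Σᵢ |λᵢ(A)|`. [folklore] -/
theorem traceAbs_eq_sum_abs_eigenvalues (A : Matrix ι ι ℂ) (hA : A.IsHermitian) :
    traceAbs A = ∑ i, |hA.eigenvalues i| :=
  re_trace_cfc A hA _

/-- `Tr |A| ≥ 0`. [folklore] -/
theorem traceAbs_nonneg (A : Matrix ι ι ℂ) (hA : A.IsHermitian) : 0 ≤ traceAbs A := by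
  rw [traceAbs_eq_sum_abs_eigenvalues A hA]
  exact Finset.sum_nonneg fun i _ => abs_nonneg _

/-- `Tr |-A| = Tr |A|`. [folklore] -/
theorem traceAbs_neg (A : Matrix ι ι ℂ) (hA : A.IsHermitian) : traceAbs (-A) = traceAbs A := by
  have hA' : IsSelfAdjoint A := hA
  have hfin := (Matrix.finite_real_spectrum (A := A)).image (fun x : ℝ => -x)
  have key : cfc (fun x : ℝ => |x|) (-A) = cfc (fun x : ℝ => |x|) A := by
    rw [← cfc_comp_neg (fun x : ℝ => |x|) A (hfin.continuousOn _)]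
    exact cfc_congr fun x _ => abs_neg x
  rw [traceAbs, traceAbs, key]

/-! ### The Frobenius Cauchy–Schwarz inequality for the trace -/

omit [DecidableEq ι] in
/-- `Re Tr (X X†) = Σ |X_{ij}|²`. [folklore] -/
theorem re_trace_mul_conjTranspose_self (X : Matrix ι ι ℂ) :
    (Matrix.trace (X * Xᴴ)).re = ∑ i, ∑ j, ‖X i j‖ ^ 2 := by
  rw [Matrix.trace, Complex.re_sum]
  refine Finset.sum_congr rfl fun i _ => ?_
  rw [Matrix.diag_apply, Matrix.mul_apply, Complex.re_sum]
  refine Finset.sum_congr rfl fun j _ => ?_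
  rw [Matrix.conjTranspose_apply, RCLike.star_def, Complex.mul_conj, ← Complex.sq_norm]
  norm_cast

omit [DecidableEq ι] in
/-- `Re Tr (Y† Y) = Σ |Y_{ji}|²`. [folklore] -/
theorem re_trace_conjTranspose_mul_self (Y : Matrix ι ι ℂ) :
    (Matrix.trace (Yᴴ * Y)).re = ∑ i, ∑ j, ‖Y j i‖ ^ 2 := by
  rw [Matrix.trace, Complex.re_sum]
  refine Finset.sum_congr rfl fun i _ => ?_
  rw [Matrix.diag_apply, Matrix.mul_apply, Complex.re_sum]
  refine Finset.sum_congr rfl fun j _ => ?_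
  rw [Matrix.conjTranspose_apply, RCLike.star_def, mul_comm, Complex.mul_conj, ← Complex.sq_norm]
  norm_cast

omit [DecidableEq ι] in
/-- **Cauchy–Schwarz for the trace**: `Re Tr(XY) ≤ ‖X‖_F ‖Y‖_F`, with the Frobenius norms written
as `√(Re Tr XX†)` and `√(Re Tr Y†Y)`. [folklore] -/
theorem re_trace_mul_le (X Y : Matrix ι ι ℂ) :
    (Matrix.trace (X * Y)).re ≤
      Real.sqrt ((Matrix.trace (X * Xᴴ)).re) * Real.sqrt ((Matrix.trace (Yᴴ * Y)).re) := by
  rw [re_trace_mul_conjTranspose_self, re_trace_conjTranspose_mul_self]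
  have h1 : (Matrix.trace (X * Y)).re ≤ ∑ i, ∑ j, ‖X i j‖ * ‖Y j i‖ := by
    rw [Matrix.trace, Complex.re_sum]
    refine Finset.sum_le_sum fun i _ => ?_
    rw [Matrix.diag_apply, Matrix.mul_apply, Complex.re_sum]
    refine Finset.sum_le_sum fun j _ => ?_
    calc (X i j * Y j i).re ≤ ‖X i j * Y j i‖ := Complex.re_le_norm _
      _ = ‖X i j‖ * ‖Y j i‖ := norm_mul _ _
  refine h1.trans ?_
  rw [← Fintype.sum_prod_type' (fun i j => ‖X i j‖ * ‖Y j i‖),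
    ← Fintype.sum_prod_type' (fun i j => ‖X i j‖ ^ 2), ← Fintype.sum_prod_type' (fun i j => ‖Y j i‖ ^ 2)]
  rw [← Real.sqrt_mul (Finset.sum_nonneg fun _ _ => sq_nonneg _)]
  refine Real.le_sqrt_of_sq_le ?_
  exact Finset.sum_mul_sq_le_sq_mul_sq _ _ _

/-! ### Traces of products with positive semidefinite matrices -/

omit [DecidableEq ι] in
/-- `Re Tr (C† C P) ≥ 0` for `P ⪰ 0`. [folklore] -/
theorem re_trace_conjTranspose_mul_mul_nonneg (C : Matrix ι ι ℂ) {P : Matrix ι ι ℂ}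
    (hP : P.PosSemidef) : 0 ≤ (Matrix.trace (Cᴴ * C * P)).re := by
  rw [Matrix.mul_assoc, trace_mul_comm]
  have h := (hP.mul_mul_conjTranspose_same C).trace_nonneg
  exact (RCLike.nonneg_iff.mp h).1


/-! ### Elementary real inequality closing the Cauchy–Schwarz argument -/

/-- If `t ≤ √a √c`, `t ≤ √a' √c` and `a + a' ≤ 2c` (all of `a, a', c ≥ 0`) then `t ≤ c`. [folklore] -/
theorem le_of_two_cauchySchwarz {t a a' c : ℝ} (ha : 0 ≤ a) (ha' : 0 ≤ a') (hc : 0 ≤ c)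
    (h1 : t ≤ Real.sqrt a * Real.sqrt c) (h2 : t ≤ Real.sqrt a' * Real.sqrt c)
    (hsum : a + a' ≤ 2 * c) : t ≤ c := by
  have hα := Real.sqrt_nonneg a
  have hα' := Real.sqrt_nonneg a'
  have hγ := Real.sqrt_nonneg c
  have hαsq := Real.sq_sqrt ha
  have hα'sq := Real.sq_sqrt ha'
  have hγsq := Real.sq_sqrt hc
  -- `(√a + √a')² ≤ 2 (a + a') ≤ 4 c = (2 √c)²`
  have hs : Real.sqrt a + Real.sqrt a' ≤ 2 * Real.sqrt c := by
    have h3 : (Real.sqrt a + Real.sqrt a') ^ 2 ≤ (2 * Real.sqrt c) ^ 2 := by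
      nlinarith [sq_nonneg (Real.sqrt a - Real.sqrt a')]
    exact (pow_le_pow_iff_left₀ (by positivity) (by positivity) two_ne_zero).1 h3
  nlinarith

/-! ### The one-body operator and the sublattice gauge -/

/-- The Falicov–Kimball one-body operator `h = -K + u S`, `S = diag(s)`: hopping matrix `K`,
coupling `u`, classical (ion / nuclear) configuration `s`. In Kennedy–Lieb's itinerant-electron
model `s_x = 2 w_x - 1 ∈ {±1}` records whether site `x` carries a nucleus; Lieb–Loss allow
`s_x ∈ [-1, 1]`. [cite: LiebLoss1993, §8 eq. (8.4)] -/
def fkOneBody (K : Matrix ι ι ℂ) (u : ℝ) (s : ι → ℝ) : Matrix ι ι ℂ :=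
  -K + Matrix.diagonal (fun x => ((u * s x : ℝ) : ℂ))

/-- The sublattice gauge transformation `V = diag(±1)` of a two-colouring `p` of the sites
(`+1` on one class, `-1` on the other). [cite: LiebLoss1993, §8 eq. (8.5)] -/
def gauge (p : ι → Bool) : Matrix ι ι ℂ :=
  Matrix.diagonal (fun x => if p x then (1 : ℂ) else -1)

section Basic

variable (K : Matrix ι ι ℂ) (u : ℝ) (s : ι → ℝ) (p : ι → Bool)

omit [Fintype ι] in
/-- A real diagonal matrix is Hermitian. [folklore] -/
theorem isHermitian_diagonal_real (d : ι → ℝ) :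
    (Matrix.diagonal (fun x => ((d x : ℝ) : ℂ))).IsHermitian := by
  rw [Matrix.IsHermitian, Matrix.diagonal_conjTranspose]
  congr 1
  funext x
  simp

omit [Fintype ι] in
/-- `h(s) = -K + uS` is Hermitian. [folklore] -/
theorem isHermitian_fkOneBody (hK : K.IsHermitian) : (fkOneBody K u s).IsHermitian :=
  hK.neg.add (isHermitian_diagonal_real _)

omit [Fintype ι] in
/-- At `u = 0`, `h = -K`. [folklore] -/
theorem fkOneBody_zero : fkOneBody K 0 s = -K := by
  rw [fkOneBody, add_eq_left]
  ext x y
  rw [Matrix.diagonal_apply]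
  split_ifs <;> simp

/-- `V² = 1`. [folklore] -/
theorem gauge_mul_gauge : gauge p * gauge p = (1 : Matrix ι ι ℂ) := by
  rw [gauge, Matrix.diagonal_mul_diagonal, ← Matrix.diagonal_one]
  congr 1
  funext x
  split_ifs <;> norm_num

omit [Fintype ι] in
/-- `V† = V`. [folklore] -/
theorem gauge_conjTranspose : (gauge p)ᴴ = (gauge p : Matrix ι ι ℂ) := by
  rw [gauge, Matrix.diagonal_conjTranspose]
  congr 1
  funext x
  by_cases hx : p x <;> simp [hx]

/-- `V K V = -K` for a hopping matrix that only connects the two colour classes ("bipartite").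
[folklore] -/
theorem gauge_mul_mul_gauge_of_bipartite (hbip : ∀ x y, p x = p y → K x y = 0) :
    gauge p * K * gauge p = -K := by
  ext x y
  rw [gauge, Matrix.mul_apply]
  simp only [Matrix.diagonal_mul, Matrix.diagonal_apply, mul_ite, mul_one, mul_zero,
    Finset.sum_ite_eq', Finset.mem_univ, if_true, Matrix.neg_apply]
  by_cases hxy : p x = p y
  · simp [hbip x y hxy]
  · cases hx : p x <;> cases hy : p y <;> simp_all

/-- `V D V = D` for a diagonal `D`. [folklore] -/
theorem gauge_mul_diagonal_mul_gauge (d : ι → ℂ) :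
    gauge p * Matrix.diagonal d * gauge p = Matrix.diagonal d := by
  rw [gauge, Matrix.diagonal_mul_diagonal, Matrix.diagonal_mul_diagonal]
  congr 1
  funext x
  split_ifs <;> ring

/-- `V h(s) V = K + uS =: h'`. [folklore] -/
theorem gauge_mul_fkOneBody_mul_gauge (hbip : ∀ x y, p x = p y → K x y = 0) :
    gauge p * fkOneBody K u s * gauge p = K + Matrix.diagonal (fun x => ((u * s x : ℝ) : ℂ)) := by
  rw [fkOneBody, Matrix.mul_add, Matrix.add_mul, Matrix.mul_neg, Matrix.neg_mul,
    gauge_mul_mul_gauge_of_bipartite K p hbip, neg_neg, gauge_mul_diagonal_mul_gauge]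

end Basic


/-! ### Functional calculus: the sign of `h` and the roots of `K² + u²` -/

/-- The sign function used to build `sgn(A)` (value `1` at `0`). [folklore] -/
def sgn (x : ℝ) : ℝ := if 0 ≤ x then 1 else -1

/-- `sgn² = 1`. [folklore] -/
theorem sgn_mul_sgn (x : ℝ) : sgn x * sgn x = 1 := by
  unfold sgn; split_ifs <;> norm_num

/-- `x sgn x = |x|`. [folklore] -/
theorem self_mul_sgn (x : ℝ) : x * sgn x = |x| := by
  unfold sgn
  split_ifs with h
  · rw [mul_one, abs_of_nonneg h]
  · rw [mul_neg, mul_one, abs_of_neg (lt_of_not_ge h)]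

/-- `√(x² + u²)`. [folklore] -/
def sqrtQ (u : ℝ) (x : ℝ) : ℝ := Real.sqrt (x ^ 2 + u ^ 2)
/-- `(x² + u²)^{1/4}`. [folklore] -/
def rootQ (u : ℝ) (x : ℝ) : ℝ := Real.sqrt (Real.sqrt (x ^ 2 + u ^ 2))
/-- `(x² + u²)^{-1/4}`. [folklore] -/
def rootQInv (u : ℝ) (x : ℝ) : ℝ := (Real.sqrt (Real.sqrt (x ^ 2 + u ^ 2)))⁻¹
/-- `(x² + u²)^{-1/2}`. [folklore] -/
def sqrtQInv (u : ℝ) (x : ℝ) : ℝ := (Real.sqrt (x ^ 2 + u ^ 2))⁻¹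

/-- `x² + u² > 0` for `u ≠ 0`. [folklore] -/
theorem q_pos {u : ℝ} (hu : u ≠ 0) (x : ℝ) : 0 < x ^ 2 + u ^ 2 := by positivity

/-- `(q^{1/4})² = q^{1/2}`. [folklore] -/
theorem rootQ_mul_rootQ (u x : ℝ) : rootQ u x * rootQ u x = sqrtQ u x :=
  Real.mul_self_sqrt (Real.sqrt_nonneg _)

/-- `q^{-1/4} q^{1/4} = 1`. [folklore] -/
theorem rootQInv_mul_rootQ {u : ℝ} (hu : u ≠ 0) (x : ℝ) : rootQInv u x * rootQ u x = 1 := by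
  have h : 0 < Real.sqrt (Real.sqrt (x ^ 2 + u ^ 2)) :=
    Real.sqrt_pos.2 (Real.sqrt_pos.2 (q_pos hu x))
  exact inv_mul_cancel₀ h.ne'

/-- `(q^{-1/4})² = q^{-1/2}`. [folklore] -/
theorem rootQInv_mul_rootQInv (u x : ℝ) : rootQInv u x * rootQInv u x = sqrtQInv u x := by
  rw [rootQInv, sqrtQInv, ← mul_inv, Real.mul_self_sqrt (Real.sqrt_nonneg _)]

/-- `√q = q^{-1/2} x² + u² q^{-1/2}` (`q = x² + u²`). [folklore] -/
theorem sqrtQ_eq {u : ℝ} (hu : u ≠ 0) (x : ℝ) :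
    sqrtQ u x = sqrtQInv u x * x * x + u ^ 2 * sqrtQInv u x := by
  have hq := q_pos hu x
  have hs : 0 < Real.sqrt (x ^ 2 + u ^ 2) := Real.sqrt_pos.2 hq
  rw [sqrtQ, sqrtQInv]
  field_simp
  rw [Real.sq_sqrt hq.le]

/-- `q^{-1/2} ≥ 0`. [folklore] -/
theorem sqrtQInv_nonneg (u x : ℝ) : 0 ≤ sqrtQInv u x := by
  rw [sqrtQInv]; positivity

section CFC

variable {A K : Matrix ι ι ℂ}

/-- A real function of a matrix (functional calculus) is Hermitian. [folklore] -/
theorem isHermitian_cfc (A : Matrix ι ι ℂ) (f : ℝ → ℝ) : (cfc f A).IsHermitian :=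
  (cfc_predicate f A : IsSelfAdjoint _)

/-- `sgn(A)² = 1`. [folklore] -/
theorem cfc_sgn_mul_self (hA : A.IsHermitian) : cfc sgn A * cfc sgn A = 1 := by
  have hA' : IsSelfAdjoint A := hA
  have hfin := Matrix.finite_real_spectrum (A := A)
  rw [← cfc_mul sgn sgn A (hfin.continuousOn _) (hfin.continuousOn _)]
  have : (spectrum ℝ A).EqOn (fun x => sgn x * sgn x) (fun _ => 1) := fun x _ => sgn_mul_sgn x
  rw [cfc_congr this, cfc_const_one ℝ A]

/-- `A sgn(A) = |A|`. [folklore] -/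
theorem mul_cfc_sgn (hA : A.IsHermitian) : A * cfc sgn A = cfc (fun x : ℝ => |x|) A := by
  have hA' : IsSelfAdjoint A := hA
  have hfin := Matrix.finite_real_spectrum (A := A)
  have h1 : cfc (fun x : ℝ => x * sgn x) A = A * cfc sgn A := by
    rw [cfc_mul (fun x : ℝ => x) sgn A (hfin.continuousOn _) (hfin.continuousOn _), cfc_id' ℝ A]
  rw [← h1]
  exact cfc_congr fun x _ => self_mul_sgn x

/-- `R⁻¹ R = 1` for `R = (K² + u²)^{1/4}`. [folklore] -/
theorem cfc_rootQInv_mul_cfc_rootQ (hK : K.IsHermitian) {u : ℝ} (hu : u ≠ 0) :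
    cfc (rootQInv u) K * cfc (rootQ u) K = 1 := by
  have hK' : IsSelfAdjoint K := hK
  have hfin := Matrix.finite_real_spectrum (A := K)
  rw [← cfc_mul (rootQInv u) (rootQ u) K (hfin.continuousOn _) (hfin.continuousOn _)]
  have : (spectrum ℝ K).EqOn (fun x => rootQInv u x * rootQ u x) (fun _ => 1) :=
    fun x _ => rootQInv_mul_rootQ hu x
  rw [cfc_congr this, cfc_const_one ℝ K]

/-- `R R = √(K² + u²)`. [folklore] -/
theorem cfc_rootQ_mul_self (K : Matrix ι ι ℂ) (u : ℝ) :
    cfc (rootQ u) K * cfc (rootQ u) K = cfc (sqrtQ u) K := by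
  have hfin := Matrix.finite_real_spectrum (A := K)
  rw [← cfc_mul (rootQ u) (rootQ u) K (hfin.continuousOn _) (hfin.continuousOn _)]
  exact cfc_congr fun x _ => rootQ_mul_rootQ u x

/-- `R⁻¹ R⁻¹ = (K² + u²)^{-1/2}`. [folklore] -/
theorem cfc_rootQInv_mul_self (K : Matrix ι ι ℂ) (u : ℝ) :
    cfc (rootQInv u) K * cfc (rootQInv u) K = cfc (sqrtQInv u) K := by
  have hfin := Matrix.finite_real_spectrum (A := K)
  rw [← cfc_mul (rootQInv u) (rootQInv u) K (hfin.continuousOn _) (hfin.continuousOn _)]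
  exact cfc_congr fun x _ => rootQInv_mul_rootQInv u x

/-- `√(K² + u²) = (K² + u²)^{-1/2} K K + u² (K² + u²)^{-1/2}`. [folklore] -/
theorem cfc_sqrtQ_eq (hK : K.IsHermitian) {u : ℝ} (hu : u ≠ 0) :
    cfc (sqrtQ u) K = cfc (sqrtQInv u) K * K * K + (u ^ 2) • cfc (sqrtQInv u) K := by
  have hK' : IsSelfAdjoint K := hK
  have hfin := Matrix.finite_real_spectrum (A := K)
  have h1 : cfc (fun x => sqrtQInv u x * x * x) K = cfc (sqrtQInv u) K * K * K := by
    rw [cfc_mul (fun x => sqrtQInv u x * x) (fun x => x) K (hfin.continuousOn _) (hfin.continuousOn _),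
      cfc_mul (sqrtQInv u) (fun x => x) K (hfin.continuousOn _) (hfin.continuousOn _), cfc_id' ℝ K]
  have h2 : cfc (fun x => u ^ 2 * sqrtQInv u x) K = (u ^ 2) • cfc (sqrtQInv u) K :=
    cfc_const_mul (u ^ 2) (sqrtQInv u) K (hfin.continuousOn _)
  rw [← h1, ← h2, ← cfc_add K (fun x => sqrtQInv u x * x * x) (fun x => u ^ 2 * sqrtQInv u x)
    (hfin.continuousOn _) (hfin.continuousOn _)]
  exact cfc_congr fun x _ => sqrtQ_eq hu x

end CFC

/-! ### The Kennedy–Lieb inequality -/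

section Main

variable {K : Matrix ι ι ℂ}

/-- One Cauchy–Schwarz step: for Hermitian `B` with `Tr|h| = Re Tr(B W)`-type factorisation.
If `W† = W`, `W W = 1` then `Re Tr (B W) ≤ √(Re Tr (B m⁻¹ B)) · √(Re Tr m)` where
`m = √(K² + u²)`, written with the fourth roots `R`, `R⁻¹`. [folklore] -/
theorem re_trace_mul_le_sqrt_mul_sqrt (hK : K.IsHermitian) {u : ℝ} (hu : u ≠ 0)
    {B W : Matrix ι ι ℂ} (hB : B.IsHermitian) (hW : Wᴴ = W) (hWW : W * W = 1) :
    (Matrix.trace (B * W)).re ≤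
      Real.sqrt ((Matrix.trace (B * cfc (sqrtQInv u) K * B)).re) *
        Real.sqrt ((Matrix.trace (cfc (sqrtQ u) K)).re) := by
  set R := cfc (rootQ u) K with hR
  set Ri := cfc (rootQInv u) K with hRi
  have hRh : Rᴴ = R := (isHermitian_cfc K (rootQ u)).eq
  have hRih : Riᴴ = Ri := (isHermitian_cfc K (rootQInv u)).eq
  have hfac : B * W = (B * Ri) * (R * W) := by
    rw [Matrix.mul_assoc, ← Matrix.mul_assoc Ri, hRi, hR, cfc_rootQInv_mul_cfc_rootQ hK hu,
      Matrix.one_mul]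
  have hX : (B * Ri) * (B * Ri)ᴴ = B * cfc (sqrtQInv u) K * B := by
    rw [Matrix.conjTranspose_mul, hRih, hB.eq, Matrix.mul_assoc, ← Matrix.mul_assoc Ri, hRi,
      cfc_rootQInv_mul_self, ← Matrix.mul_assoc]
  have hY : (R * W)ᴴ * (R * W) = W * cfc (sqrtQ u) K * W := by
    rw [Matrix.conjTranspose_mul, hW, hRh, Matrix.mul_assoc, ← Matrix.mul_assoc R, hR,
      cfc_rootQ_mul_self, ← Matrix.mul_assoc]
  have hYtr : Matrix.trace (W * cfc (sqrtQ u) K * W) = Matrix.trace (cfc (sqrtQ u) K) := by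
    rw [trace_mul_cycle, hWW, Matrix.one_mul]
  have h := re_trace_mul_le (B * Ri) (R * W)
  rw [← hfac, hX, hY, hYtr] at h
  exact h

/-- `Re Tr (B m⁻¹ B) ≥ 0` (`m⁻¹ = R⁻¹ R⁻¹`, so this is a Frobenius norm squared). [folklore] -/
theorem re_trace_mul_cfc_sqrtQInv_mul_nonneg (K : Matrix ι ι ℂ) (u : ℝ) {B : Matrix ι ι ℂ}
    (hB : B.IsHermitian) : 0 ≤ (Matrix.trace (B * cfc (sqrtQInv u) K * B)).re := by
  set Ri := cfc (rootQInv u) K with hRi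
  have hRih : Riᴴ = Ri := (isHermitian_cfc K (rootQInv u)).eq
  have hX : (B * Ri) * (B * Ri)ᴴ = B * cfc (sqrtQInv u) K * B := by
    rw [Matrix.conjTranspose_mul, hRih, hB.eq, Matrix.mul_assoc, ← Matrix.mul_assoc Ri, hRi,
      cfc_rootQInv_mul_self, ← Matrix.mul_assoc]
  rw [← hX, re_trace_mul_conjTranspose_self]
  positivity

omit [DecidableEq ι] in
/-- The diagonal of a bipartite hopping matrix vanishes, so `Tr K = 0`. [folklore] -/
theorem trace_eq_zero_of_bipartite (p : ι → Bool) (hbip : ∀ x y, p x = p y → K x y = 0) :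
    Matrix.trace K = 0 :=
  Finset.sum_eq_zero fun x _ => hbip x x rfl

/-- **Kennedy–Lieb chessboard inequality** (Kennedy–Lieb 1986, Lemma 2.2; Lieb–Loss 1993,
Lemma 8.1 with `F = Tr √·`): for a Hermitian hopping matrix `K` on a two-coloured ("bipartite")
vertex set — `K_{xy} = 0` whenever `x`, `y` have the same colour — a coupling `u ≠ 0` and any
configuration `s` with `|s_x| ≤ 1`,
`Tr |-K + u S| ≤ Tr √(K² + u²) = Σᵢ √(λᵢ(K)² + u²)`,
the value attained at the two chessboard configurations `S = ±V`
(`traceAbs_fkOneBody_chessboard`). Printed proof: `Tr|h| = Tr √(h²)`, `h' = VhV` has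
`Tr √(h'²) = Tr √(h²)` and `½(h² + h'²) = K² + u²S² ≤ K² + u²`, and `Tr √·` is concave and
monotone. Here the concavity step is carried out by hand: with `m = √(K² + u²)` and
`W = sgn h`, `Tr|h| = Re Tr (hW) = Re Tr ((h m^{-1/2})(m^{1/2} W)) ≤ (Tr h m⁻¹ h)^{1/2} (Tr m)^{1/2}`
(Cauchy–Schwarz), the same for `h'`, and `Tr (h m⁻¹ h) + Tr (h' m⁻¹ h') ≤ 2 Tr m`.
[cite: KennedyLieb1986, Lemma 2.2 and Theorem 2.1 (as transcribed in LiebLoss1993 §8)][cite: LiebLoss1993, §8, Lemma 8.1] -/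
theorem traceAbs_fkOneBody_le_of_ne_zero (hK : K.IsHermitian) (p : ι → Bool)
    (hbip : ∀ x y, p x = p y → K x y = 0) {u : ℝ} (hu : u ≠ 0) {s : ι → ℝ}
    (hs : ∀ x, |s x| ≤ 1) :
    traceAbs (fkOneBody K u s) ≤ ∑ i, Real.sqrt (hK.eigenvalues i ^ 2 + u ^ 2) := by
  -- the cast of characters
  set h := fkOneBody K u s with hh
  set D : Matrix ι ι ℂ := Matrix.diagonal (fun x => ((u * s x : ℝ) : ℂ)) with hD
  set h' : Matrix ι ι ℂ := K + D with hh'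
  set V : Matrix ι ι ℂ := gauge p with hV
  set W : Matrix ι ι ℂ := cfc sgn h with hW
  set W' : Matrix ι ι ℂ := V * W * V with hW'
  set minv : Matrix ι ι ℂ := cfc (sqrtQInv u) K with hminv
  set m : Matrix ι ι ℂ := cfc (sqrtQ u) K with hm
  have hhH : h.IsHermitian := isHermitian_fkOneBody K u s hK
  have hDH : D.IsHermitian := isHermitian_diagonal_real _
  have hh'H : h'.IsHermitian := hK.add hDH
  have hWH : Wᴴ = W := (isHermitian_cfc h sgn).eq
  have hWW : W * W = 1 := cfc_sgn_mul_self hhH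
  have hVV : V * V = 1 := gauge_mul_gauge p
  have hVH : Vᴴ = V := gauge_conjTranspose p
  have hW'H : W'ᴴ = W' := by
    rw [hW', Matrix.conjTranspose_mul, Matrix.conjTranspose_mul, hVH, hWH, Matrix.mul_assoc]
  have hW'W' : W' * W' = 1 := by
    calc W' * W' = V * W * (V * V) * W * V := by simp only [hW', Matrix.mul_assoc]
      _ = 1 := by rw [hVV, Matrix.mul_one, Matrix.mul_assoc V, hWW, Matrix.mul_one, hVV]
  -- `Tr|h| = Re Tr (h W) = Re Tr (h' W')`
  have ht : traceAbs h = (Matrix.trace (h * W)).re := by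
    rw [traceAbs, hW, mul_cfc_sgn hhH]
  have hVhV : V * h * V = h' := by
    rw [hV, hh, hh', hD, gauge_mul_fkOneBody_mul_gauge K u s p hbip]
  have ht' : (Matrix.trace (h' * W')).re = (Matrix.trace (h * W)).re := by
    have : h' * W' = V * (h * W) * V := by
      calc h' * W' = V * h * (V * V) * W * V := by rw [← hVhV, hW']; simp only [Matrix.mul_assoc]
        _ = V * (h * W) * V := by rw [hVV, Matrix.mul_one]; simp only [Matrix.mul_assoc]
    rw [this, trace_mul_cycle, hVV, Matrix.one_mul]
  -- the two Cauchy–Schwarz bounds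
  have h1 := re_trace_mul_le_sqrt_mul_sqrt hK hu hhH hWH hWW
  have h2 := re_trace_mul_le_sqrt_mul_sqrt hK hu hh'H hW'H hW'W'
  rw [ht'] at h2
  have ha := re_trace_mul_cfc_sqrtQInv_mul_nonneg K u hhH
  have ha' := re_trace_mul_cfc_sqrtQInv_mul_nonneg K u hh'H
  -- `c = Re Tr m = Σ √(λᵢ² + u²)`
  have hc : (Matrix.trace m).re = ∑ i, Real.sqrt (hK.eigenvalues i ^ 2 + u ^ 2) :=
    re_trace_cfc K hK (sqrtQ u)
  have hc0 : 0 ≤ (Matrix.trace m).re := by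
    rw [hc]; exact Finset.sum_nonneg fun i _ => Real.sqrt_nonneg _
  -- `c = Re Tr (m⁻¹ K K) + u² Re Tr m⁻¹`
  have hc1 : (Matrix.trace m).re =
      (Matrix.trace (minv * K * K)).re + u ^ 2 * (Matrix.trace minv).re := by
    rw [hm, cfc_sqrtQ_eq hK hu, Matrix.trace_add, Matrix.trace_smul, Complex.add_re,
      Complex.smul_re, smul_eq_mul]
  -- `a + a' = 2 Re Tr (m⁻¹ K K) + 2 Re Tr (m⁻¹ D D)`
  have hsq : h * h + h' * h' = (K * K + D * D) + (K * K + D * D) := by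
    rw [hh, hh', fkOneBody, ← hD]; noncomm_ring
  have haa : (Matrix.trace (h * minv * h)).re + (Matrix.trace (h' * minv * h')).re =
      2 * ((Matrix.trace (minv * K * K)).re + (Matrix.trace (minv * (D * D))).re) := by
    rw [trace_mul_cycle h minv h, trace_mul_cycle h' minv h', ← Complex.add_re, ← Matrix.trace_add,
      ← Matrix.add_mul, hsq, Matrix.add_mul, Matrix.add_mul, Matrix.trace_add, Matrix.trace_add,
      trace_mul_cycle K K minv, trace_mul_comm (D * D) minv, Complex.add_re, Complex.add_re]
    ring
  -- `Re Tr (m⁻¹ D D) ≤ u² Re Tr m⁻¹` since `u² - D² ⪰ 0` and `m⁻¹ = R⁻¹ R⁻¹ ⪰ 0`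
  have hDD : (Matrix.trace (minv * (D * D))).re ≤ u ^ 2 * (Matrix.trace minv).re := by
    set P : Matrix ι ι ℂ := Matrix.diagonal (fun x => ((u ^ 2 - (u * s x) ^ 2 : ℝ) : ℂ)) with hP
    have hPpsd : P.PosSemidef := by
      rw [hP, Matrix.posSemidef_diagonal_iff]
      intro x
      have hx : (s x) ^ 2 ≤ 1 := (sq_le_one_iff_abs_le_one _).2 (hs x)
      exact Complex.zero_le_real.2 (by nlinarith [sq_nonneg u])
    have hPeq : P = ((u ^ 2 : ℝ) : ℂ) • (1 : Matrix ι ι ℂ) - D * D := by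
      rw [hP, hD, Matrix.diagonal_mul_diagonal, Matrix.smul_one_eq_diagonal, Matrix.diagonal_sub]
      congr 1
      funext x
      push_cast
      ring
    set Ri : Matrix ι ι ℂ := cfc (rootQInv u) K with hRi
    have hRih : Riᴴ = Ri := (isHermitian_cfc K (rootQInv u)).eq
    have hpos := re_trace_conjTranspose_mul_mul_nonneg Ri hPpsd
    rw [hRih, hRi, cfc_rootQInv_mul_self, ← hminv, hPeq, Matrix.mul_sub, Matrix.mul_smul,
      Matrix.mul_one, Matrix.trace_sub, Matrix.trace_smul, Complex.sub_re, smul_eq_mul,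
      Complex.re_ofReal_mul] at hpos
    linarith
  have hsum : (Matrix.trace (h * minv * h)).re + (Matrix.trace (h' * minv * h')).re ≤
      2 * (Matrix.trace m).re := by
    rw [haa, hc1]; nlinarith
  -- conclude
  rw [ht, ← hc]
  exact le_of_two_cauchySchwarz ha ha' hc0 h1 h2 hsum

/-- **Kennedy–Lieb chessboard inequality**, all couplings `u` (for `u = 0` both sides equal
`Tr |K|`): `Tr |-K + uS| ≤ Σᵢ √(λᵢ(K)² + u²)` for bipartite Hermitian `K` and `|s_x| ≤ 1`.
[cite: KennedyLieb1986, Lemma 2.2 and Theorem 2.1][cite: LiebLoss1993, §8, Lemma 8.1] -/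
theorem traceAbs_fkOneBody_le (hK : K.IsHermitian) (p : ι → Bool)
    (hbip : ∀ x y, p x = p y → K x y = 0) (u : ℝ) {s : ι → ℝ} (hs : ∀ x, |s x| ≤ 1) :
    traceAbs (fkOneBody K u s) ≤ ∑ i, Real.sqrt (hK.eigenvalues i ^ 2 + u ^ 2) := by
  rcases eq_or_ne u 0 with rfl | hu
  · rw [fkOneBody_zero, traceAbs_neg K hK, traceAbs_eq_sum_abs_eigenvalues K hK]
    refine le_of_eq (Finset.sum_congr rfl fun i _ => ?_)
    rw [zero_pow two_ne_zero, add_zero, Real.sqrt_sq_eq_abs]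
  · exact traceAbs_fkOneBody_le_of_ne_zero hK p hbip hu hs

/-- The chessboard configuration of a two-colouring: `s_x = +1` on one colour class and `-1` on
the other (`S = V`; the opposite chessboard `S = -V` is the chessboard of the swapped colouring).
[cite: LiebLoss1993, §8 eq. (8.5)] -/
def chessboard (p : ι → Bool) : ι → ℝ := fun x => if p x then 1 else -1

omit [Fintype ι] in
/-- `u diag(chessboard) = u V`. [folklore] -/
theorem diagonal_chessboard (p : ι → Bool) (u : ℝ) :
    Matrix.diagonal (fun x => ((u * chessboard p x : ℝ) : ℂ)) = u • gauge p := by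
  ext x y
  rw [Matrix.smul_apply, gauge, Matrix.diagonal_apply, Matrix.diagonal_apply, chessboard]
  split_ifs <;> simp

/-- **Equality at the chessboard** (Kennedy–Lieb 1986, Theorem 2.1; Lieb–Loss 1993, Lemma 8.1:
`K² + u² = h²` when `S = ±V`): `Tr |-K + uV| = Σᵢ √(λᵢ(K)² + u²)`, because `KV + VK = 0` gives
`(-K + uV)² = K² + u²`. [cite: LiebLoss1993, §8, Lemma 8.1] -/
theorem traceAbs_fkOneBody_chessboard (hK : K.IsHermitian) (p : ι → Bool)
    (hbip : ∀ x y, p x = p y → K x y = 0) (u : ℝ) :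
    traceAbs (fkOneBody K u (chessboard p)) = ∑ i, Real.sqrt (hK.eigenvalues i ^ 2 + u ^ 2) := by
  have hK' : IsSelfAdjoint K := hK
  set h := fkOneBody K u (chessboard p) with hh
  set V : Matrix ι ι ℂ := gauge p with hV
  have hhH : h.IsHermitian := isHermitian_fkOneBody K u _ hK
  have hh' : IsSelfAdjoint h := hhH
  have hVV : V * V = 1 := gauge_mul_gauge p
  have hVK : V * K = -(K * V) := by
    have h1 : V * K * V = -K := gauge_mul_mul_gauge_of_bipartite K p hbip
    calc V * K = V * K * (V * V) := by rw [hVV, Matrix.mul_one]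
      _ = -(K * V) := by rw [← Matrix.mul_assoc, h1, Matrix.neg_mul]
  have hhV : h = -K + u • V := by rw [hh, fkOneBody, diagonal_chessboard]
  -- `h² = K² + u²`
  have hsq : h * h = cfc (fun x : ℝ => x ^ 2 + u ^ 2) K := by
    have hfin := Matrix.finite_real_spectrum (A := K)
    rw [cfc_add K (fun x : ℝ => x ^ 2) (fun _ => u ^ 2) (hfin.continuousOn _) (hfin.continuousOn _),
      cfc_pow (fun x : ℝ => x) 2 K, cfc_id' ℝ K, cfc_const (u ^ 2) K, Algebra.algebraMap_eq_smul_one,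
      hhV]
    rw [add_mul, mul_add, mul_add, Matrix.smul_mul, Matrix.mul_smul, Matrix.smul_mul,
      Matrix.mul_smul, neg_mul_neg, Matrix.mul_neg, hVK, neg_neg, Matrix.neg_mul, smul_neg, hVV,
      smul_smul, sq, sq]
    abel
  -- `|h| = √(h²) = √(K² + u²)`
  have habs : cfc (fun x : ℝ => |x|) h = cfc (sqrtQ u) K := by
    have hfinh := Matrix.finite_real_spectrum (A := h)
    have hfin := Matrix.finite_real_spectrum (A := K)
    have e1 : cfc (fun x : ℝ => |x|) h = cfc (Real.sqrt ∘ fun x : ℝ => x ^ 2) h :=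
      cfc_congr fun x _ => by simp [Real.sqrt_sq_eq_abs]
    have e2 : cfc (Real.sqrt ∘ fun x : ℝ => x ^ 2) h = cfc Real.sqrt (cfc (fun x : ℝ => x ^ 2) h) :=
      cfc_comp Real.sqrt (fun x : ℝ => x ^ 2) h (hg := (hfinh.image _).continuousOn _)
        (hf := hfinh.continuousOn _)
    have e3 : cfc (fun x : ℝ => x ^ 2) h = h * h := by
      rw [cfc_pow (fun x : ℝ => x) 2 h, cfc_id' ℝ h, sq]
    have e4 : cfc (sqrtQ u) K = cfc Real.sqrt (cfc (fun x : ℝ => x ^ 2 + u ^ 2) K) :=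
      cfc_comp Real.sqrt (fun x : ℝ => x ^ 2 + u ^ 2) K (hg := (hfin.image _).continuousOn _)
        (hf := hfin.continuousOn _)
    rw [e1, e2, e3, hsq, ← e4]
  rw [traceAbs, habs]
  exact re_trace_cfc K hK (sqrtQ u)

end Main

/-! ### The Langer–Mattis one-body bound: `Tr (h γ) ≥` (sum of the negative eigenvalues of `h`) -/

section NegativePart

variable {A : Matrix ι ι ℂ}

/-- `max(-x, 0) = (|x| - x)/2`. [folklore] -/
theorem max_neg_zero_eq (x : ℝ) : max (-x) 0 = (|x| - x) / 2 := by
  rcases le_or_gt 0 x with h | h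
  · rw [max_eq_right (by linarith), abs_of_nonneg h]; ring
  · rw [max_eq_left (by linarith), abs_of_neg h]; ring

/-- `Re Tr A = Σᵢ λᵢ(A)`. [folklore] -/
theorem re_trace_eq_sum_eigenvalues (hA : A.IsHermitian) :
    (Matrix.trace A).re = ∑ i, hA.eigenvalues i := by
  rw [hA.trace_eq_sum_eigenvalues, Complex.re_sum]
  simp

/-- `Re Tr A⁻ = (Tr|A| - Re Tr A)/2` for the negative part `A⁻ = max(-A, 0)`. [folklore] -/
theorem re_trace_negPart (hA : A.IsHermitian) :
    (Matrix.trace (cfc (fun x : ℝ => max (-x) 0) A)).re = (traceAbs A - (Matrix.trace A).re) / 2 := by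
  rw [re_trace_cfc A hA, traceAbs_eq_sum_abs_eigenvalues A hA, re_trace_eq_sum_eigenvalues hA,
    ← Finset.sum_sub_distrib, Finset.sum_div]
  exact Finset.sum_congr rfl fun i _ => max_neg_zero_eq _

/-- A functional calculus of a nonnegative function is a Gram matrix `C† C`,
`C = √f(A)`. [folklore] -/
theorem cfc_eq_conjTranspose_mul_self (A : Matrix ι ι ℂ) {f : ℝ → ℝ} (hf : ∀ x, 0 ≤ f x) :
    cfc f A = (cfc (fun x => Real.sqrt (f x)) A)ᴴ * cfc (fun x => Real.sqrt (f x)) A := by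
  have hfin := Matrix.finite_real_spectrum (A := A)
  rw [(isHermitian_cfc A _).eq,
    ← cfc_mul (fun x => Real.sqrt (f x)) (fun x => Real.sqrt (f x)) A (hfin.continuousOn _)
      (hfin.continuousOn _)]
  exact cfc_congr fun x _ => (Real.mul_self_sqrt (hf x)).symm

/-- **Langer–Mattis one-body bound.** For a Hermitian `A` and a one-body density matrix
`0 ≤ γ ≤ 1`: `Re Tr (A γ) ≥ -Tr A⁻ = (Re Tr A - Tr|A|)/2`, the sum of the negative eigenvalues
of `A`. (The expectation of `dΓ(A)` in any fermionic state is `Tr (A γ)` with such a `γ`.)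
[cite: LiebLoss1993, §8, proof of Theorem 8.2] -/
theorem re_trace_mul_ge_of_le_one (hA : A.IsHermitian) {γ : Matrix ι ι ℂ} (hγ : γ.PosSemidef)
    (hγ' : (1 - γ).PosSemidef) :
    ((Matrix.trace A).re - traceAbs A) / 2 ≤ (Matrix.trace (A * γ)).re := by
  have hA' : IsSelfAdjoint A := hA
  have hfin := Matrix.finite_real_spectrum (A := A)
  set Ap := cfc (fun x : ℝ => max x 0) A with hAp
  set Am := cfc (fun x : ℝ => max (-x) 0) A with hAm
  have hdec : A = Ap - Am := by
    rw [hAp, hAm, ← cfc_sub (fun x : ℝ => max x 0) (fun x : ℝ => max (-x) 0) A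
      (hfin.continuousOn _) (hfin.continuousOn _)]
    conv_lhs => rw [← cfc_id' ℝ A]
    exact cfc_congr fun x _ => (max_zero_sub_max_neg_zero_eq_self x).symm
  have hp : 0 ≤ (Matrix.trace (Ap * γ)).re := by
    rw [hAp, cfc_eq_conjTranspose_mul_self A (f := fun x : ℝ => max x 0) (fun x => le_max_right _ _)]
    exact re_trace_conjTranspose_mul_mul_nonneg _ hγ
  have hm : (Matrix.trace (Am * γ)).re ≤ (Matrix.trace Am).re := by
    have h1 : 0 ≤ (Matrix.trace (Am * (1 - γ))).re := by
      rw [hAm, cfc_eq_conjTranspose_mul_self A (f := fun x : ℝ => max (-x) 0)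
        (fun x => le_max_right _ _)]
      exact re_trace_conjTranspose_mul_mul_nonneg _ hγ'
    rw [Matrix.mul_sub, Matrix.mul_one, Matrix.trace_sub, Complex.sub_re] at h1
    linarith
  have hmtr : (Matrix.trace Am).re = (traceAbs A - (Matrix.trace A).re) / 2 := re_trace_negPart hA
  have : (Matrix.trace (A * γ)).re = (Matrix.trace (Ap * γ)).re - (Matrix.trace (Am * γ)).re := by
    rw [hdec, Matrix.sub_mul, Matrix.trace_sub, Complex.sub_re]
  rw [this]
  linarith

/-- The same bound for partial sums of eigenvalues: every sum of eigenvalues of `A` over a set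
of indices is at least the sum of the negative eigenvalues `(Re Tr A - Tr|A|)/2`. [folklore] -/
theorem sum_eigenvalues_ge (hA : A.IsHermitian) (I : Finset ι) :
    ((Matrix.trace A).re - traceAbs A) / 2 ≤ ∑ i ∈ I, hA.eigenvalues i := by
  rw [re_trace_eq_sum_eigenvalues hA, traceAbs_eq_sum_abs_eigenvalues A hA, ← Finset.sum_sub_distrib,
    Finset.sum_div]
  calc ∑ i, (hA.eigenvalues i - |hA.eigenvalues i|) / 2
      ≤ ∑ i ∈ I, (hA.eigenvalues i - |hA.eigenvalues i|) / 2 := by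
        rw [← Finset.sum_sdiff (Finset.subset_univ I)]
        have : ∑ i ∈ Finset.univ \ I, (hA.eigenvalues i - |hA.eigenvalues i|) / 2 ≤ 0 :=
          Finset.sum_nonpos fun i _ => by linarith [le_abs_self (hA.eigenvalues i)]
        linarith
    _ ≤ ∑ i ∈ I, hA.eigenvalues i :=
        Finset.sum_le_sum fun i _ => by linarith [neg_abs_le (hA.eigenvalues i)]

end NegativePart

/-! ### Assembly: the Kennedy–Lieb–Langer–Mattis lower bounds -/

section Assembly

variable {K : Matrix ι ι ℂ}

/-- `Re Tr (-K + uS) = u Σ_x s_x` for bipartite `K`. [folklore] -/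
theorem re_trace_fkOneBody (p : ι → Bool) (hbip : ∀ x y, p x = p y → K x y = 0)
    (u : ℝ) (s : ι → ℝ) : (Matrix.trace (fkOneBody K u s)).re = u * ∑ x, s x := by
  rw [fkOneBody, Matrix.trace_add, Matrix.trace_neg, trace_eq_zero_of_bipartite p hbip, neg_zero,
    zero_add, Matrix.trace_diagonal, Complex.re_sum, Finset.mul_sum]
  exact Finset.sum_congr rfl fun x _ => Complex.ofReal_re _

/-- **Tr|h(s)| is maximal at the chessboard** (Kennedy–Lieb 1986, Theorem 2.1; Lieb–Loss 1993,
Lemma 8.1): `Tr |-K + uS| ≤ Tr |-K + uV|` for every `|s| ≤ 1`.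
[cite: KennedyLieb1986, Theorem 2.1][cite: LiebLoss1993, §8, Lemma 8.1] -/
theorem traceAbs_fkOneBody_le_chessboard (hK : K.IsHermitian) (p : ι → Bool)
    (hbip : ∀ x y, p x = p y → K x y = 0) (u : ℝ) {s : ι → ℝ} (hs : ∀ x, |s x| ≤ 1) :
    traceAbs (fkOneBody K u s) ≤ traceAbs (fkOneBody K u (chessboard p)) := by
  rw [traceAbs_fkOneBody_chessboard hK p hbip u]
  exact traceAbs_fkOneBody_le hK p hbip u hs

/-- **Kennedy–Lieb–Langer–Mattis bound, density-matrix form.** For bipartite Hermitian `K`,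
`u ≠ 0`, `|s_x| ≤ 1` and every one-body density matrix `0 ≤ γ ≤ 1`:
`Re Tr ((-K + uS) γ) ≥ ½ (u Σ_x s_x - Σᵢ √(λᵢ(K)² + u²))`.
This is the configuration-independent lower bound behind the Falicov–Kimball / Langer–Mattis
lower bounds for the Hubbard model (the electronic energy in the field of the configuration `s`
is at least the sum of the negative eigenvalues of `h(s)`, which is at least its chessboard value).
[cite: KennedyLieb1986, Theorem 2.1][cite: LiebLoss1993, §8, Theorem 8.2] -/
theorem kennedyLieb_re_trace_mul_ge (hK : K.IsHermitian) (p : ι → Bool)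
    (hbip : ∀ x y, p x = p y → K x y = 0) (u : ℝ) {s : ι → ℝ} (hs : ∀ x, |s x| ≤ 1)
    {γ : Matrix ι ι ℂ} (hγ : γ.PosSemidef) (hγ' : (1 - γ).PosSemidef) :
    (u * ∑ x, s x - ∑ i, Real.sqrt (hK.eigenvalues i ^ 2 + u ^ 2)) / 2 ≤
      (Matrix.trace (fkOneBody K u s * γ)).re := by
  have h1 := re_trace_mul_ge_of_le_one (isHermitian_fkOneBody K u s hK) hγ hγ'
  have h2 := traceAbs_fkOneBody_le hK p hbip u hs
  rw [re_trace_fkOneBody p hbip u s] at h1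
  linarith

/-- **Kennedy–Lieb–Langer–Mattis bound, eigenvalue form.** Every partial sum of eigenvalues of
`h(s) = -K + uS` (in particular the sum of its `a` lowest eigenvalues, the ground-state energy of
`a` free fermions in the configuration `s`) is at least `½ (u Σ_x s_x - Σᵢ √(λᵢ(K)² + u²))`.
[cite: KennedyLieb1986, Theorem 2.1][cite: LiebLoss1993, §8, Theorem 8.2] -/
theorem kennedyLieb_sum_eigenvalues_ge (hK : K.IsHermitian) (p : ι → Bool)
    (hbip : ∀ x y, p x = p y → K x y = 0) (u : ℝ) {s : ι → ℝ} (hs : ∀ x, |s x| ≤ 1)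
    (I : Finset ι) :
    (u * ∑ x, s x - ∑ i, Real.sqrt (hK.eigenvalues i ^ 2 + u ^ 2)) / 2 ≤
      ∑ i ∈ I, (isHermitian_fkOneBody K u s hK).eigenvalues i := by
  have h1 := sum_eigenvalues_ge (isHermitian_fkOneBody K u s hK) I
  have h2 := traceAbs_fkOneBody_le hK p hbip u hs
  rw [re_trace_fkOneBody p hbip u s] at h1
  linarith

end Assembly

end Literature.MathematicalPhysics.QuantumLattice.FalicovKimball
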